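import Mathlib
import Literature.Analysis.Quadrature.ScrambledNetSmoothIntegrands

/-!
# Completeness of the Walsh system and Parseval's identity (on the digit space)

[cite: DickPillichshammer2010, Thm. A.11], [cite: DickPillichshammer2010, Thm. A.19],
[cite: DickPillichshammer2010, eq. (13.6)] (J. Dick, F. Pillichshammer, *Digital Nets and
Sequences*, CUP 2010, Appendix A.2, pp. 546–550 (Theorem A.11, Lemma A.17, (A.1), (A.2),
Theorem A.19) and §13.2, p. 402 (the nested ANOVA decomposition and eq. (13.6))).

Continuation of `ScrambledNetSmoothIntegrands` (Walsh coefficients `walshCoeffD`, level means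
`levelMean`, and `sum_walshCoeffD_mul_walshD`: `Σ_{k < b^n} f̂(k) wal_k = E_n f`, the digit-space
form of Lemma A.17). The files `ScrambledNetVariance` (Theorem 13.5), `ScrambledDigitalNetVariance`
(Theorem 13.9) and `ScrambledNetSmoothIntegrands` (Theorem 13.22) treat Walsh polynomials /
integrands of finite precision, where §13.2 of the book silently uses, for general `f ∈ L_2`,
that the Walsh system is a complete orthonormal system ("Since `f ∈ L_2([0,1])` and the Walsh
function system is complete, we can use Plancherel's identity", p. 402). This file proves that
input on the digit space `ℕ → Fin b` with the uniform digit law `digitSeqMeasure b`.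

## Contents

* `walshSum b S f = Σ_{k ∈ S} f̂(k) wal_k` (for `S = {0,…,m-1}` the partial sum `S_m(·, f)`);
  orthonormality computations [Prop. A.10]: `walshCoeffD_sum_mul_walshD`,
  `integral_norm_sq_sum_mul_walshD'`; the remainder `f - S_S f` is orthogonal to `wal_k`, `k ∈ S`
  (`integral_sub_walshSum_mul_conj_walshD`).
* Best approximation (Pythagoras) `∫|f - Σ_{k∈S} c_k wal_k|² = ∫|f - S_S f|² + Σ_{k∈S}|f̂(k)-c_k|²`
  (`integral_norm_sq_sub_sum_mul_walshD`); identity (A.2)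
  `∫|f|² = ∫|f - S_S f|² + Σ_{k∈S}|f̂(k)|²` (`integral_norm_sq_eq_add_sum_norm_sq_walshCoeffD`);
  Bessel's inequality (A.1) (`sum_norm_sq_walshCoeffD_le`, `summable_norm_sq_walshCoeffD`); the
  error `∫|f - S_S f|²` is antitone in `S` (`integral_norm_sq_sub_walshSum_anti`).
* Theorem A.11, density of Walsh polynomials: for continuous `g`, `S_{b^n} g = E_n g → g`
  uniformly (`tendstoUniformly_levelMean`; Lemma A.17 + uniform continuity on the compact digit
  space); for `f ∈ L_2`, `∫|f - S_{b^n} f|² → 0` (`tendsto_integral_norm_sq_sub_walshSum_pow`,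
  `tendsto_integral_norm_sq_sub_levelMean`), by density of continuous functions in `L_2` and best
  approximation: `∫|f - S_{b^n} f|² ≤ ∫|f - S_{b^n} g|² ≤ 2∫|f - g|² + 2‖g - S_{b^n} g‖_∞²`.
* Theorem A.19: (3) `∫|f - S_m f|² → 0` along all partial sums
  (`tendsto_integral_norm_sq_sub_walshSum`); (2) Parseval / Plancherel `Σ_k |f̂(k)|² = ∫|f|²`
  (`hasSum_norm_sq_walshCoeffD`, `tsum_norm_sq_walshCoeffD`; tail form
  `∫|f - S_m f|² = Σ_{k ≥ m}|f̂(k)|²`, `hasSum_norm_sq_walshCoeffD_add`); (1) completeness: an `L_2`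
  function with vanishing Walsh coefficients is `0` a.e.
  (`ae_eq_zero_of_forall_walshCoeffD_eq_zero`; uniqueness of coefficients
  `ae_eq_of_forall_walshCoeffD_eq`).
* §13.2, the nested ANOVA decomposition and eq. (13.6): `Var[f] = ∫|f - ∫f|² = ∫|f|² - |∫f|²`
  (`integral_norm_sq_sub_integral`) and `Σ_{ℓ ≥ 1} σ_ℓ²(f) = Σ_{k ≥ 1}|f̂(k)|² = Var[f]`
  (`hasSum_blockVariance_walshCoeffD`, `hasSum_blockVariance_walshCoeffD'`), with the tail
  `∫|f - E_L f|² = Σ_{ℓ > L} σ_ℓ²(f)` (`hasSum_blockVariance_walshCoeffD_add`).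

## Modelling and referee notes

1. *Digit space, `s = 1`.* As in the preceding files, `[0,1)` with Lebesgue measure is replaced
   by `ℕ → Fin b` with `digitSeqMeasure b` (pushed forward to Lebesgue measure by the digit
   expansion), and "`f ∈ L_2`" is `MemLp f 2 (digitSeqMeasure b)` with the `L_2`-norms written as
   integrals `∫ |·|²`; we do not pass to the quotient `Lp ℂ 2` or package the result as a
   `HilbertBasis`. The book states Appendix A.2 for the `s`-dimensional system
   (`𝐤 ∈ ℕ₀^s`, partial sums over boxes `𝐧 = (n₁,…,n_s)`); we formalise `s = 1`, which is what
   §13.2 ((13.5), (13.6)) uses; the `s`-dimensional case is the same argument with `walshDPi`.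
2. *Route to Theorem A.19 (3).* The book obtains `L_2`-convergence of all partial sums through
   Lemma A.18 (the partial sums are Cauchy, `L_2` is complete) and completeness. We instead use
   the subsequence `m = b^n` from the proof of Theorem A.11 together with the monotonicity of
   `∫|f - S_m f|² = ∫|f|² - Σ_{k<m}|f̂(k)|²` in `m` (by (A.2)); the infinite sum `S(·, f)` as an
   element of `L_2` is never needed, and Parseval (2) and completeness (1) follow from (3) and
   (A.2) exactly as in the book's proof of Theorem A.19.
3. *Density step.* The book: Walsh polynomials are sup-norm dense in `C([0,1]^s)`, "which in
   turn is dense in `L_2`". Here: bounded continuous functions are dense in `L_2` of the finite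
   (weakly regular, Borel) measure `digitSeqMeasure b` on the compact metrisable digit space
   (Mathlib's `MemLp.exists_boundedContinuous_integral_rpow_sub_le`); uniform continuity is taken
   with respect to Mathlib's `PiNat.metricSpace` (first-differing-digit metric, under which the
   elementary cylinder of order `n` around `x` is the closed ball of radius `2^{-n}`), which
   induces the product topology; the book's `b^{ns} λ_s(x ⊖ [0,b^{-n})^s) = 1` estimate is
   `norm_cylinderMean_sub_le`.
4. *(13.6).* Stated with `σ_0² := 0` (the empty block, `blockVariance b c 0 = 0` as defined in
   `ScrambledNetVariance`) so that the sum runs over `ℓ ∈ ℕ`; `f̂(0) = ∫ f = 𝔼[f]`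
   (`walshCoeffD_zero_eq_integral`).
-/

open MeasureTheory Complex Finset Filter Topology
open scoped ENNReal ComplexConjugate

noncomputable section

namespace Literature.Analysis.Quadrature

variable (b : ℕ)

/-- The **Walsh sum** `Σ_{k ∈ S} f̂(k) ₖwal_b` of `f` over a finite set `S` of wavenumbers — for
`S = {0, …, n-1}` the `n`-th partial sum `S_n(·, f)` of the Walsh series of `f`
[cite: DickPillichshammer2010, Thm. A.11] (proof, p. 548:
`S_n(x, f) = Σ_{l=0}^{n-1} f̂(l) wal_l(x)`, here `s = 1`, on the digit space). -/
def walshSum [NeZero b] (S : Finset ℕ) (f : (ℕ → Fin b) → ℂ) (η : ℕ → Fin b) : ℂ :=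
  ∑ k ∈ S, walshCoeffD b f k * walshD b k η

variable {b}

/-- Membership in the elementary cylinder of order `n` around `η`: the first `n` digits agree.
[folklore] -/
private theorem mem_digitCylinder_digitsPrefix_iff {n : ℕ} {η ζ : ℕ → Fin b} :
    ζ ∈ digitCylinder b n (digitsPrefix b n η) ↔ ∀ i < n, ζ i = η i := by
  simp only [digitCylinder, Set.mem_setOf_eq, digitsPrefix, funext_iff, Fin.forall_iff]

section Basics

variable [NeZero b]

/-! ### Integrability and square-integrability bookkeeping -/

/-- `f conj(wal_k)` is integrable for integrable `f` (`|wal_k| = 1`). [folklore] -/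
private theorem integrable_mul_conj_walshD'' {f : (ℕ → Fin b) → ℂ}
    (hf : Integrable f (digitSeqMeasure b)) (k : ℕ) :
    Integrable (fun η => f η * conj (walshD b k η)) (digitSeqMeasure b) :=
  hf.mul_bdd (Complex.continuous_conj.measurable.comp (measurable_walshD k)).aestronglyMeasurable
    (ae_of_all _ fun η => by rw [Complex.norm_conj, norm_walshD])

/-- `wal_k conj(wal_l)` is integrable on the digit space. [folklore] -/
private theorem integrable_walshD_mul_conj_walshD' (k l : ℕ) :
    Integrable (fun η => walshD b k η * conj (walshD b l η)) (digitSeqMeasure b) :=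
  (integrable_const (1 : ℝ)).mono'
    ((measurable_walshD k).mul
      (Complex.continuous_conj.measurable.comp (measurable_walshD l))).aestronglyMeasurable
    (ae_of_all _ fun η => by rw [norm_mul, Complex.norm_conj, norm_walshD, norm_walshD, mul_one])

/-- A finite Walsh combination `Σ_{k ∈ S} c_k wal_k` is measurable. [folklore] -/
private theorem measurable_sum_mul_walshD (S : Finset ℕ) (c : ℕ → ℂ) :
    Measurable fun η : ℕ → Fin b => ∑ k ∈ S, c k * walshD b k η :=
  Finset.measurable_sum _ fun k _ => (measurable_walshD k).const_mul _

/-- A finite Walsh combination is bounded by the sum of the moduli of its coefficients.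
[folklore] -/
private theorem norm_sum_mul_walshD_le (S : Finset ℕ) (c : ℕ → ℂ) (η : ℕ → Fin b) :
    ‖∑ k ∈ S, c k * walshD b k η‖ ≤ ∑ k ∈ S, ‖c k‖ :=
  (norm_sum_le _ _).trans (le_of_eq (sum_congr rfl fun k _ => by
    rw [norm_mul, norm_walshD, mul_one]))

/-- A finite Walsh combination is square integrable (indeed in every `L_p`). [folklore] -/
private theorem memLp_sum_mul_walshD (S : Finset ℕ) (c : ℕ → ℂ) (p : ℝ≥0∞) :
    MemLp (fun η : ℕ → Fin b => ∑ k ∈ S, c k * walshD b k η) p (digitSeqMeasure b) :=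
  MemLp.of_bound (measurable_sum_mul_walshD S c).aestronglyMeasurable _
    (ae_of_all _ (norm_sum_mul_walshD_le S c))

/-- A finite Walsh combination is integrable. [folklore] -/
private theorem integrable_sum_mul_walshD (S : Finset ℕ) (c : ℕ → ℂ) :
    Integrable (fun η : ℕ → Fin b => ∑ k ∈ S, c k * walshD b k η) (digitSeqMeasure b) :=
  (memLp_sum_mul_walshD S c 1).integrable le_rfl

/-- An `L_2` function on the (probability) digit space is integrable. [folklore] -/
private theorem integrable_of_memLp_two {f : (ℕ → Fin b) → ℂ}
    (hf : MemLp f 2 (digitSeqMeasure b)) : Integrable f (digitSeqMeasure b) :=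
  hf.integrable one_le_two

/-- `|f|²` is integrable for `f ∈ L_2`. [folklore] -/
private theorem integrable_norm_sq {f : (ℕ → Fin b) → ℂ} (hf : MemLp f 2 (digitSeqMeasure b)) :
    Integrable (fun η => ‖f η‖ ^ 2) (digitSeqMeasure b) :=
  (memLp_two_iff_integrable_sq_norm hf.1).1 hf

/-- `f conj(f)` is integrable for `f ∈ L_2` (`|f conj f| = |f|²`). [folklore] -/
private theorem integrable_mul_conj_self {f : (ℕ → Fin b) → ℂ}
    (hf : MemLp f 2 (digitSeqMeasure b)) :
    Integrable (fun η => f η * conj (f η)) (digitSeqMeasure b) :=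
  (integrable_norm_sq hf).mono' (hf.1.mul (Complex.continuous_conj.comp_aestronglyMeasurable hf.1))
    (ae_of_all _ fun η => by rw [norm_mul, Complex.norm_conj, sq])

/-- `∫ |F|²` as a complex number is `∫ F conj(F)`. [folklore] -/
private theorem ofReal_integral_norm_sq (F : (ℕ → Fin b) → ℂ) :
    ((∫ η, ‖F η‖ ^ 2 ∂digitSeqMeasure b : ℝ) : ℂ) =
      ∫ η, F η * conj (F η) ∂digitSeqMeasure b := by
  rw [← integral_complex_ofReal]
  push_cast
  simp_rw [← Complex.mul_conj']

/-! ### Walsh coefficients of Walsh combinations; orthogonality of the remainder -/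

/-- The Walsh coefficients of a finite Walsh combination are its coefficients:
`(Σ_{l ∈ S} c_l wal_l)^(k) = c_k [k ∈ S]` (orthonormality of the Walsh system
[cite: DickPillichshammer2010, Prop. A.10]). -/
theorem walshCoeffD_sum_mul_walshD (hb : 1 < b) (S : Finset ℕ) (c : ℕ → ℂ) (k : ℕ) :
    walshCoeffD b (fun η => ∑ l ∈ S, c l * walshD b l η) k = if k ∈ S then c k else 0 := by
  have hI : ∀ l, Integrable (fun η => c l * (walshD b l η * conj (walshD b k η)))
      (digitSeqMeasure b) := fun l => (integrable_walshD_mul_conj_walshD' l k).const_mul _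
  have hexp : ∀ η : ℕ → Fin b, (∑ l ∈ S, c l * walshD b l η) * conj (walshD b k η) =
      ∑ l ∈ S, c l * (walshD b l η * conj (walshD b k η)) := by
    intro η
    rw [sum_mul]
    exact sum_congr rfl fun l _ => by ring
  rw [walshCoeffD]
  simp_rw [hexp]
  rw [integral_finsetSum _ fun l _ => hI l]
  simp_rw [integral_const_mul, integral_walshD_mul_conj_walshD hb, mul_ite, mul_one, mul_zero]
  rw [Finset.sum_ite_eq' S k]

/-- `∫ |Σ_{k ∈ S} c_k wal_k|² = Σ_{k ∈ S} |c_k|²` (orthonormality of the Walsh system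
[cite: DickPillichshammer2010, Prop. A.10]; the computation behind [cite: DickPillichshammer2010,
Lemma A.18]). -/
theorem integral_norm_sq_sum_mul_walshD' (hb : 1 < b) (S : Finset ℕ) (c : ℕ → ℂ) :
    ∫ η, ‖∑ k ∈ S, c k * walshD b k η‖ ^ 2 ∂digitSeqMeasure b = ∑ k ∈ S, ‖c k‖ ^ 2 := by
  have hI : ∀ k, Integrable (fun η => conj (c k) *
      ((∑ l ∈ S, c l * walshD b l η) * conj (walshD b k η))) (digitSeqMeasure b) := fun k =>
    (integrable_mul_conj_walshD'' (integrable_sum_mul_walshD S c) k).const_mul _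
  have hexp : ∀ η : ℕ → Fin b, (∑ l ∈ S, c l * walshD b l η) * conj (∑ k ∈ S, c k * walshD b k η)
      = ∑ k ∈ S, conj (c k) * ((∑ l ∈ S, c l * walshD b l η) * conj (walshD b k η)) := by
    intro η
    rw [map_sum, mul_sum]
    exact sum_congr rfl fun k _ => by rw [map_mul]; ring
  have key : ((∫ η, ‖∑ k ∈ S, c k * walshD b k η‖ ^ 2 ∂digitSeqMeasure b : ℝ) : ℂ) =
      ((∑ k ∈ S, ‖c k‖ ^ 2 : ℝ) : ℂ) := by
    rw [ofReal_integral_norm_sq]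
    simp_rw [hexp]
    rw [integral_finsetSum _ fun k _ => hI k]
    push_cast
    refine sum_congr rfl fun k hk => ?_
    have h := walshCoeffD_sum_mul_walshD hb S c k
    rw [walshCoeffD, if_pos hk] at h
    rw [integral_const_mul, h, mul_comm, Complex.mul_conj']
  exact_mod_cast key

/-- **The remainder `f - Σ_{k ∈ S} f̂(k) wal_k` is orthogonal to `wal_k`, `k ∈ S`**:
`∫ (f - S_S f) conj(wal_k) = f̂(k) - f̂(k) = 0`. [cite: DickPillichshammer2010, Thm. A.19]
(proof, p. 550: "`⟨f - S(·, f), ₖwal_b⟩ = 0` for all `k`") -/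
theorem integral_sub_walshSum_mul_conj_walshD (hb : 1 < b) {f : (ℕ → Fin b) → ℂ}
    (hf : Integrable f (digitSeqMeasure b)) {S : Finset ℕ} {k : ℕ} (hk : k ∈ S) :
    ∫ η, (f η - walshSum b S f η) * conj (walshD b k η) ∂digitSeqMeasure b = 0 := by
  have h1 := integrable_mul_conj_walshD'' hf k
  have h2 : Integrable (fun η => walshSum b S f η * conj (walshD b k η)) (digitSeqMeasure b) :=
    integrable_mul_conj_walshD'' (integrable_sum_mul_walshD (b := b) S (walshCoeffD b f)) k
  simp_rw [sub_mul]
  rw [integral_sub h1 h2]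
  have h := walshCoeffD_sum_mul_walshD hb S (walshCoeffD b f) k
  rw [walshCoeffD, if_pos hk] at h
  change ∫ η, f η * conj (walshD b k η) ∂digitSeqMeasure b -
    ∫ η, (∑ l ∈ S, walshCoeffD b f l * walshD b l η) * conj (walshD b k η) ∂digitSeqMeasure b = 0
  rw [h, ← walshCoeffD, sub_self]

/-! ### Pythagoras: best approximation by Walsh combinations, identity (A.2), Bessel (A.1) -/

/-- **Pythagoras for Walsh sums**: for `f ∈ L_2` and any Walsh combination with wavenumbers in a
finite set `S`,
`∫ |f - Σ_{k ∈ S} c_k wal_k|² = ∫ |f - Σ_{k ∈ S} f̂(k) wal_k|² + Σ_{k ∈ S} |f̂(k) - c_k|²`;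
in particular the Walsh sum `S_S f` is the best `L_2`-approximation of `f` from the span of
`{wal_k : k ∈ S}` (the orthogonal projection). [cite: DickPillichshammer2010, Thm. A.11]
(proof, pp. 549–550, display (A.2), of which this is the polarised form) -/
theorem integral_norm_sq_sub_sum_mul_walshD (hb : 1 < b) {f : (ℕ → Fin b) → ℂ}
    (hf : MemLp f 2 (digitSeqMeasure b)) (S : Finset ℕ) (c : ℕ → ℂ) :
    ∫ η, ‖f η - ∑ k ∈ S, c k * walshD b k η‖ ^ 2 ∂digitSeqMeasure b =
      ∫ η, ‖f η - walshSum b S f η‖ ^ 2 ∂digitSeqMeasure b +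
        ∑ k ∈ S, ‖walshCoeffD b f k - c k‖ ^ 2 := by
  set G : (ℕ → Fin b) → ℂ := fun η => f η - walshSum b S f η with hG
  set d : ℕ → ℂ := fun k => walshCoeffD b f k - c k with hd
  set Q : (ℕ → Fin b) → ℂ := fun η => ∑ k ∈ S, d k * walshD b k η with hQ
  have hfI : Integrable f (digitSeqMeasure b) := integrable_of_memLp_two hf
  have hGmem : MemLp G 2 (digitSeqMeasure b) := hf.sub (memLp_sum_mul_walshD S (walshCoeffD b f) 2)
  have hQmem : MemLp Q 2 (digitSeqMeasure b) := memLp_sum_mul_walshD S d 2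
  have hGI : Integrable G (digitSeqMeasure b) := integrable_of_memLp_two hGmem
  have hFGQ : ∀ η, f η - ∑ k ∈ S, c k * walshD b k η = G η + Q η := by
    intro η
    simp only [hG, hQ, hd, walshSum, sub_mul, sum_sub_distrib]
    ring
  -- the cross terms vanish
  have hIGk : ∀ k, Integrable (fun η => conj (d k) * (G η * conj (walshD b k η)))
      (digitSeqMeasure b) := fun k => (integrable_mul_conj_walshD'' hGI k).const_mul _
  have hGQ : ∫ η, G η * conj (Q η) ∂digitSeqMeasure b = 0 := by
    have hexp : ∀ η, G η * conj (Q η) = ∑ k ∈ S, conj (d k) * (G η * conj (walshD b k η)) := by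
      intro η
      rw [hQ]
      simp only [map_sum, map_mul, mul_sum]
      exact sum_congr rfl fun k _ => by ring
    simp_rw [hexp]
    rw [integral_finsetSum _ fun k _ => hIGk k]
    refine sum_eq_zero fun k hk => ?_
    rw [integral_const_mul, hG]
    change conj (d k) * ∫ η, (f η - walshSum b S f η) * conj (walshD b k η) ∂digitSeqMeasure b = 0
    rw [integral_sub_walshSum_mul_conj_walshD hb hfI hk, mul_zero]
  have hQG : ∫ η, Q η * conj (G η) ∂digitSeqMeasure b = 0 := by
    have : (fun η => Q η * conj (G η)) = fun η => conj (G η * conj (Q η)) := by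
      funext η; rw [map_mul, Complex.conj_conj, mul_comm]
    rw [this, integral_conj, hGQ, map_zero]
  have hQQ : ∫ η, Q η * conj (Q η) ∂digitSeqMeasure b = ((∑ k ∈ S, ‖d k‖ ^ 2 : ℝ) : ℂ) := by
    rw [← ofReal_integral_norm_sq, hQ, integral_norm_sq_sum_mul_walshD' hb S d]
  -- integrability of the four products
  have hIGG : Integrable (fun η => G η * conj (G η)) (digitSeqMeasure b) :=
    integrable_mul_conj_self hGmem
  have hIQQ : Integrable (fun η => Q η * conj (Q η)) (digitSeqMeasure b) :=
    integrable_mul_conj_self hQmem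
  have hIGQ : Integrable (fun η => G η * conj (Q η)) (digitSeqMeasure b) :=
    hGI.mul_bdd (Complex.continuous_conj.comp_aestronglyMeasurable hQmem.1)
      (ae_of_all _ fun η => by
        rw [Complex.norm_conj]; exact norm_sum_mul_walshD_le S d η)
  have hIQG : Integrable (fun η => Q η * conj (G η)) (digitSeqMeasure b) := by
    have : (fun η => Q η * conj (G η)) = fun η => conj (G η * conj (Q η)) := by
      funext η; rw [map_mul, Complex.conj_conj, mul_comm]
    rw [this]
    exact (Complex.conjLIE.toContinuousLinearEquiv.toContinuousLinearMap.integrable_comp hIGQ)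
  have h12 : Integrable (fun η => G η * conj (G η) + G η * conj (Q η)) (digitSeqMeasure b) :=
    hIGG.add hIGQ
  have h34 : Integrable (fun η => Q η * conj (G η) + Q η * conj (Q η)) (digitSeqMeasure b) :=
    hIQG.add hIQQ
  have key : ((∫ η, ‖f η - ∑ k ∈ S, c k * walshD b k η‖ ^ 2 ∂digitSeqMeasure b : ℝ) : ℂ) =
      ((∫ η, ‖G η‖ ^ 2 ∂digitSeqMeasure b : ℝ) : ℂ) + ((∑ k ∈ S, ‖d k‖ ^ 2 : ℝ) : ℂ) := by
    rw [ofReal_integral_norm_sq, ofReal_integral_norm_sq, ← hQQ]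
    simp_rw [hFGQ]
    have hsplit : ∀ η, (G η + Q η) * conj (G η + Q η) =
        G η * conj (G η) + G η * conj (Q η) + (Q η * conj (G η) + Q η * conj (Q η)) := by
      intro η; rw [map_add]; ring
    simp_rw [hsplit]
    rw [integral_add h12 h34, integral_add hIGG hIGQ, integral_add hIQG hIQQ, hGQ, hQG, add_zero,
      zero_add]
  exact_mod_cast key

/-- **Identity (A.2)**: for `f ∈ L_2` and a finite set `S` of wavenumbers,
`∫ |f|² = ∫ |f - Σ_{k ∈ S} f̂(k) wal_k|² + Σ_{k ∈ S} |f̂(k)|²`.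
[cite: DickPillichshammer2010, Thm. A.11] (proof, p. 549, display (A.2):
`0 ≤ ⟨f - S_n(·,f), f - S_n(·,f)⟩ = ⟨f,f⟩ - Σ_{k=0}^{n-1} |f̂(k)|²`) -/
theorem integral_norm_sq_eq_add_sum_norm_sq_walshCoeffD (hb : 1 < b) {f : (ℕ → Fin b) → ℂ}
    (hf : MemLp f 2 (digitSeqMeasure b)) (S : Finset ℕ) :
    ∫ η, ‖f η‖ ^ 2 ∂digitSeqMeasure b =
      ∫ η, ‖f η - walshSum b S f η‖ ^ 2 ∂digitSeqMeasure b + ∑ k ∈ S, ‖walshCoeffD b f k‖ ^ 2 := by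
  have h := integral_norm_sq_sub_sum_mul_walshD hb hf S (fun _ => 0)
  simpa only [zero_mul, sum_const_zero, sub_zero] using h

/-- **Bessel's inequality (A.1)** (finite form): `Σ_{k ∈ S} |f̂(k)|² ≤ ∫ |f|²` for every finite `S`.
[cite: DickPillichshammer2010, Thm. A.11] (proof, p. 549, display (A.1):
`Σ_{k=0}^∞ |f̂(k)|² ≤ ∫ |f|² dx`) -/
theorem sum_norm_sq_walshCoeffD_le (hb : 1 < b) {f : (ℕ → Fin b) → ℂ}
    (hf : MemLp f 2 (digitSeqMeasure b)) (S : Finset ℕ) :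
    ∑ k ∈ S, ‖walshCoeffD b f k‖ ^ 2 ≤ ∫ η, ‖f η‖ ^ 2 ∂digitSeqMeasure b := by
  rw [integral_norm_sq_eq_add_sum_norm_sq_walshCoeffD hb hf S]
  exact le_add_of_nonneg_left (integral_nonneg fun η => sq_nonneg _)

/-- **Bessel's inequality (A.1)** (summability): `Σ_k |f̂(k)|² < ∞` for `f ∈ L_2`.
[cite: DickPillichshammer2010, Thm. A.11] (proof, p. 549, display (A.1)) -/
theorem summable_norm_sq_walshCoeffD (hb : 1 < b) {f : (ℕ → Fin b) → ℂ}
    (hf : MemLp f 2 (digitSeqMeasure b)) : Summable fun k => ‖walshCoeffD b f k‖ ^ 2 :=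
  summable_of_sum_le (fun _ => sq_nonneg _) (sum_norm_sq_walshCoeffD_le hb hf)

/-- The `L_2`-error of the Walsh sums is antitone in the set of wavenumbers:
`S ⊆ T ⇒ ∫ |f - S_T f|² ≤ ∫ |f - S_S f|²` (by (A.2)). [cite: DickPillichshammer2010, Thm. A.11]
(proof, p. 549, (A.2)) -/
theorem integral_norm_sq_sub_walshSum_anti (hb : 1 < b) {f : (ℕ → Fin b) → ℂ}
    (hf : MemLp f 2 (digitSeqMeasure b)) {S T : Finset ℕ} (hST : S ⊆ T) :
    ∫ η, ‖f η - walshSum b T f η‖ ^ 2 ∂digitSeqMeasure b ≤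
      ∫ η, ‖f η - walshSum b S f η‖ ^ 2 ∂digitSeqMeasure b := by
  have hS := integral_norm_sq_eq_add_sum_norm_sq_walshCoeffD hb hf S
  have hT := integral_norm_sq_eq_add_sum_norm_sq_walshCoeffD hb hf T
  have hle : ∑ k ∈ S, ‖walshCoeffD b f k‖ ^ 2 ≤ ∑ k ∈ T, ‖walshCoeffD b f k‖ ^ 2 :=
    sum_le_sum_of_subset_of_nonneg hST fun k _ _ => sq_nonneg _
  linarith

/-! ### Partial sums over `{0, …, b^n - 1}` are the level means -/

/-- `S_{b^n}(·, f) = Σ_{k < b^n} f̂(k) wal_k` is the level-`n` mean of `f` (the mean of `f` over the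
elementary interval of order `n` containing the point) [cite: DickPillichshammer2010, Lemma A.17]
(the display `S_{b_n}(x, f) = b^{ns} ∫_{x ⊖ [0,b^{-n})^s} f(t) dt`, proof of Thm. A.11, p. 549). -/
theorem walshSum_range_pow (hb : 1 < b) {f : (ℕ → Fin b) → ℂ}
    (hf : Integrable f (digitSeqMeasure b)) (n : ℕ) (η : ℕ → Fin b) :
    walshSum b (range (b ^ n)) f η = levelMean b n f η :=
  sum_walshCoeffD_mul_walshD hb hf n η

end Basics

/-! ### Uniform approximation of continuous functions by their level means -/

section UniformApproximation

variable [NeZero b]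

/-- A continuous `g` on the (compact) digit space is uniformly continuous, hence for every `ε > 0`
there is a depth `N` such that `|g(ζ) - g(η)| < ε` whenever `ζ, η` share their first `n ≥ N`
digits (`g ∈ C([0,1]^s)` "is also uniformly continuous", proof of
[cite: DickPillichshammer2010, Thm. A.11], p. 549). Uniform continuity is taken with respect to
Mathlib's first-differing-digit metric `PiNat.metricSpace` (a local `letI`, inducing the product
topology), in which the cylinder of order `n` around `η` is the closed `2^{-n}`-ball. -/
private theorem exists_level_norm_sub_lt {g : (ℕ → Fin b) → ℂ} (hg : Continuous g) {ε : ℝ}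
    (hε : 0 < ε) : ∃ N : ℕ, ∀ n ≥ N, ∀ η ζ : ℕ → Fin b,
      ζ ∈ digitCylinder b n (digitsPrefix b n η) → ‖g ζ - g η‖ < ε := by
  letI : MetricSpace (ℕ → Fin b) := PiNat.metricSpace
  have huc : UniformContinuous g := CompactSpace.uniformContinuous_of_continuous hg
  obtain ⟨δ, hδ, hδε⟩ := Metric.uniformContinuous_iff.1 huc ε hε
  obtain ⟨N, hN⟩ : ∃ N : ℕ, (1 / 2 : ℝ) ^ N < δ := exists_pow_lt_of_lt_one hδ (by norm_num)
  refine ⟨N, fun n hn η ζ hζ => ?_⟩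
  have hd : dist ζ η ≤ (1 / 2 : ℝ) ^ n :=
    PiNat.mem_cylinder_iff_dist_le.1
      (PiNat.mem_cylinder_iff.2 (mem_digitCylinder_digitsPrefix_iff.1 hζ))
  have hlt : dist ζ η < δ :=
    lt_of_le_of_lt (hd.trans (pow_le_pow_of_le_one (by norm_num) (by norm_num) hn)) hN
  rw [← dist_eq_norm]
  exact hδε hlt

end UniformApproximation

section Completeness

variable [NeZero b]

/-- A continuous function on the compact digit space is bounded, hence in every `L_p`.
[folklore] -/
private theorem memLp_of_continuous {g : (ℕ → Fin b) → ℂ} (hg : Continuous g) (p : ℝ≥0∞) :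
    MemLp g p (digitSeqMeasure b) := by
  obtain ⟨C, hC⟩ := isCompact_univ.exists_bound_of_continuousOn hg.continuousOn
  exact MemLp.of_bound hg.aestronglyMeasurable C (ae_of_all _ fun η => hC η (Set.mem_univ η))

/-- **Level means of a continuous function converge uniformly**:
`sup_x |S_{b^n}(x, g) - g(x)| → 0` for continuous `g` — since `S_{b^n} g(x)` is the mean of `g`
over the elementary interval of order `n` containing `x`, on which `g` oscillates by less than
`ε` once `n` is large, uniformly in `x`. [cite: DickPillichshammer2010, Thm. A.11] (proof,
p. 549: "`‖S_{b_n}(·, f) - f‖_∞ < ε` for all `n > N₀(ε)`. Hence, `‖S_{b_n}(·, f) - f‖_∞ → 0` as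
`n → ∞`") -/
theorem tendstoUniformly_levelMean {g : (ℕ → Fin b) → ℂ} (hg : Continuous g) :
    TendstoUniformly (fun n => levelMean b n g) g atTop := by
  rw [Metric.tendstoUniformly_iff]
  intro ε hε
  obtain ⟨N, hN⟩ := exists_level_norm_sub_lt hg (half_pos hε)
  have hgI : Integrable g (digitSeqMeasure b) := (memLp_of_continuous hg 1).integrable le_rfl
  filter_upwards [eventually_ge_atTop N] with n hn η
  rw [dist_comm, dist_eq_norm]
  have h : ‖levelMean b n g η - g η‖ ≤ ε / 2 :=
    norm_cylinderMean_sub_le hgI.integrableOn fun ζ hζ => (hN n hn η ζ hζ).le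
  linarith

/-- `|u + v|² ≤ 2|u|² + 2|v|²`. [folklore] -/
private theorem norm_add_sq_le (u v : ℂ) : ‖u + v‖ ^ 2 ≤ 2 * ‖u‖ ^ 2 + 2 * ‖v‖ ^ 2 := by
  nlinarith [norm_add_le u v, norm_nonneg (u + v), norm_nonneg u, norm_nonneg v,
    sq_nonneg (‖u‖ - ‖v‖)]

/-- **Theorem A.11, `L_2` part, along the partial sums `S_{b^n}`**: for `f ∈ L_2` of the digit
space, `∫ |f - S_{b^n}(·, f)|² → 0`. Proof as in the book (p. 549): continuous functions are dense
in `L_2`; for continuous `g`, `S_{b^n} g → g` uniformly (`tendstoUniformly_levelMean`); and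
`S_{b^n} f` is the best `L_2`-approximation of `f` among Walsh polynomials of degree `< b^n`
(`integral_norm_sq_sub_sum_mul_walshD`), so
`∫|f - S_{b^n} f|² ≤ ∫|f - S_{b^n} g|² ≤ 2∫|f - g|² + 2 sup|g - S_{b^n} g|²`.
[cite: DickPillichshammer2010, Thm. A.11] -/
theorem tendsto_integral_norm_sq_sub_walshSum_pow (hb : 1 < b) {f : (ℕ → Fin b) → ℂ}
    (hf : MemLp f 2 (digitSeqMeasure b)) :
    Tendsto (fun n => ∫ η, ‖f η - walshSum b (range (b ^ n)) f η‖ ^ 2 ∂digitSeqMeasure b)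
      atTop (𝓝 0) := by
  rw [Metric.tendsto_atTop]
  intro ε hε
  -- a continuous `g` with `∫ |f - g|² ≤ ε / 8`
  have hf' : MemLp f (ENNReal.ofReal 2) (digitSeqMeasure b) := by simpa using hf
  obtain ⟨g, hgε, -⟩ :=
    hf'.exists_boundedContinuous_integral_rpow_sub_le two_pos (by positivity : (0 : ℝ) < ε / 8)
  simp only [Real.rpow_two] at hgε
  have hgc : Continuous (g : (ℕ → Fin b) → ℂ) := g.continuous
  have hgmem : MemLp (g : (ℕ → Fin b) → ℂ) 2 (digitSeqMeasure b) := memLp_of_continuous hgc 2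
  have hgI : Integrable (g : (ℕ → Fin b) → ℂ) (digitSeqMeasure b) :=
    integrable_of_memLp_two hgmem
  -- a depth `N` beyond which `g` oscillates by at most `δ` on elementary cylinders, `δ² ≤ ε / 4`
  set δ : ℝ := min 1 (ε / 4) with hδdef
  have hδpos : 0 < δ := lt_min one_pos (by positivity)
  have hδ1 : δ ≤ 1 := min_le_left _ _
  have hδε : δ ≤ ε / 4 := min_le_right _ _
  have hδsq : δ ^ 2 ≤ ε / 4 := by nlinarith
  obtain ⟨N, hN⟩ := exists_level_norm_sub_lt hgc hδpos
  refine ⟨N, fun n hn => ?_⟩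
  rw [Real.dist_eq, sub_zero, abs_of_nonneg (integral_nonneg fun η => sq_nonneg _)]
  -- `|g - S_{b^n} g| ≤ δ` everywhere
  have hEg : ∀ η, ‖(g η : ℂ) - levelMean b n g η‖ ≤ δ := fun η => by
    rw [norm_sub_rev]
    exact norm_cylinderMean_sub_le hgI.integrableOn fun ζ hζ => (hN n hn η ζ hζ).le
  -- best approximation: `∫ |f - S_{b^n} f|² ≤ ∫ |f - S_{b^n} g|²`
  have hsumg : ∀ η, ∑ k ∈ range (b ^ n), walshCoeffD b g k * walshD b k η = levelMean b n g η :=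
    fun η => sum_walshCoeffD_mul_walshD hb hgI n η
  have hP := integral_norm_sq_sub_sum_mul_walshD hb hf (range (b ^ n)) (walshCoeffD b g)
  simp_rw [hsumg] at hP
  have hbest : ∫ η, ‖f η - walshSum b (range (b ^ n)) f η‖ ^ 2 ∂digitSeqMeasure b ≤
      ∫ η, ‖f η - levelMean b n g η‖ ^ 2 ∂digitSeqMeasure b := by
    rw [hP]
    exact le_add_of_nonneg_right (sum_nonneg fun k _ => sq_nonneg _)
  -- pointwise `|f - S_{b^n} g|² ≤ 2|f - g|² + 2δ²`, then integrate
  have hpt : ∀ η, ‖f η - levelMean b n g η‖ ^ 2 ≤ 2 * ‖f η - g η‖ ^ 2 + 2 * δ ^ 2 := by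
    intro η
    have h := norm_add_sq_le (f η - g η) (g η - levelMean b n g η)
    rw [sub_add_sub_cancel] at h
    have h2 : ‖(g η : ℂ) - levelMean b n g η‖ ^ 2 ≤ δ ^ 2 :=
      pow_le_pow_left₀ (norm_nonneg _) (hEg η) 2
    linarith
  have hLmem : MemLp (fun η => levelMean b n (g : (ℕ → Fin b) → ℂ) η) 2 (digitSeqMeasure b) := by
    have h := memLp_sum_mul_walshD (b := b) (range (b ^ n)) (walshCoeffD b g) 2
    simp_rw [hsumg] at h
    exact h
  have hI1 : Integrable (fun η => ‖f η - levelMean b n g η‖ ^ 2) (digitSeqMeasure b) :=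
    integrable_norm_sq (hf.sub hLmem)
  have hI2' : Integrable (fun η => 2 * ‖f η - g η‖ ^ 2) (digitSeqMeasure b) :=
    (integrable_norm_sq (hf.sub hgmem)).const_mul 2
  have hI2 : Integrable (fun η => 2 * ‖f η - g η‖ ^ 2 + 2 * δ ^ 2) (digitSeqMeasure b) :=
    hI2'.add (integrable_const _)
  have hmono := integral_mono hI1 hI2 hpt
  have hRHS : ∫ η, (2 * ‖f η - g η‖ ^ 2 + 2 * δ ^ 2) ∂digitSeqMeasure b =
      2 * ∫ η, ‖f η - g η‖ ^ 2 ∂digitSeqMeasure b + 2 * δ ^ 2 := by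
    rw [integral_add hI2' (integrable_const _), integral_const_mul, integral_const, probReal_univ,
      one_smul]
  calc ∫ η, ‖f η - walshSum b (range (b ^ n)) f η‖ ^ 2 ∂digitSeqMeasure b
      ≤ ∫ η, ‖f η - levelMean b n g η‖ ^ 2 ∂digitSeqMeasure b := hbest
    _ ≤ 2 * ∫ η, ‖f η - g η‖ ^ 2 ∂digitSeqMeasure b + 2 * δ ^ 2 := hmono.trans_eq hRHS
    _ ≤ 2 * (ε / 8) + 2 * (ε / 4) := by linarith
    _ < ε := by linarith

/-- **Theorem A.11, `L_2` part, for the level means**: `∫ |f - E_n f|² → 0` for `f ∈ L_2`, where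
`E_n f(x) = b^n ∫_{⌊y b^n⌋ = ⌊x b^n⌋} f = S_{b^n}(x, f)`. [cite: DickPillichshammer2010, Thm. A.11]
(with [cite: DickPillichshammer2010, Lemma A.17]) -/
theorem tendsto_integral_norm_sq_sub_levelMean (hb : 1 < b) {f : (ℕ → Fin b) → ℂ}
    (hf : MemLp f 2 (digitSeqMeasure b)) :
    Tendsto (fun n => ∫ η, ‖f η - levelMean b n f η‖ ^ 2 ∂digitSeqMeasure b) atTop (𝓝 0) := by
  have h := tendsto_integral_norm_sq_sub_walshSum_pow hb hf
  simp_rw [walshSum_range_pow hb (integrable_of_memLp_two hf)] at h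
  exact h

/-- **Theorem A.19 (3) / Theorem A.11 (`L_2`-convergence of the Walsh series)**: for `f ∈ L_2`,
`∫ |f - S_m(·, f)|² → 0` as `m → ∞` along ALL partial sums `S_m f = Σ_{k<m} f̂(k) wal_k` (the
error is antitone in `m` by (A.2) and tends to `0` along `m = b^n`); i.e. the Walsh polynomials
are dense in `L_2` and `L_2 = closure(span 𝒲)`. [cite: DickPillichshammer2010, Thm. A.19]
[cite: DickPillichshammer2010, Thm. A.11] -/
theorem tendsto_integral_norm_sq_sub_walshSum (hb : 1 < b) {f : (ℕ → Fin b) → ℂ}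
    (hf : MemLp f 2 (digitSeqMeasure b)) :
    Tendsto (fun m => ∫ η, ‖f η - walshSum b (range m) f η‖ ^ 2 ∂digitSeqMeasure b)
      atTop (𝓝 0) := by
  rw [Metric.tendsto_atTop]
  intro ε hε
  obtain ⟨N, hN⟩ :=
    (Metric.tendsto_atTop.1 (tendsto_integral_norm_sq_sub_walshSum_pow hb hf)) ε hε
  refine ⟨b ^ N, fun m hm => ?_⟩
  have h1 := hN N le_rfl
  rw [Real.dist_eq, sub_zero, abs_of_nonneg (integral_nonneg fun η => sq_nonneg _)] at h1 ⊢
  exact (integral_norm_sq_sub_walshSum_anti hb hf (range_subset_range.2 hm)).trans_lt h1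

/-- **Theorem A.19 (2), Parseval / Plancherel identity** for the Walsh system:
`Σ_{k=0}^∞ |f̂(k)|² = ∫ |f|²` for every `f ∈ L_2` of the digit space.
[cite: DickPillichshammer2010, Thm. A.19] -/
theorem hasSum_norm_sq_walshCoeffD (hb : 1 < b) {f : (ℕ → Fin b) → ℂ}
    (hf : MemLp f 2 (digitSeqMeasure b)) :
    HasSum (fun k => ‖walshCoeffD b f k‖ ^ 2) (∫ η, ‖f η‖ ^ 2 ∂digitSeqMeasure b) := by
  rw [hasSum_iff_tendsto_nat_of_nonneg (fun k => sq_nonneg _)]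
  have h : ∀ m, ∑ k ∈ range m, ‖walshCoeffD b f k‖ ^ 2 = ∫ η, ‖f η‖ ^ 2 ∂digitSeqMeasure b -
      ∫ η, ‖f η - walshSum b (range m) f η‖ ^ 2 ∂digitSeqMeasure b := fun m => by
    rw [integral_norm_sq_eq_add_sum_norm_sq_walshCoeffD hb hf (range m)]
    ring
  simp_rw [h]
  simpa using (tendsto_integral_norm_sq_sub_walshSum hb hf).const_sub
    (∫ η, ‖f η‖ ^ 2 ∂digitSeqMeasure b)

/-- **Parseval** (`tsum` form): `Σ' k, |f̂(k)|² = ∫ |f|²`.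
[cite: DickPillichshammer2010, Thm. A.19] -/
theorem tsum_norm_sq_walshCoeffD (hb : 1 < b) {f : (ℕ → Fin b) → ℂ}
    (hf : MemLp f 2 (digitSeqMeasure b)) :
    ∑' k, ‖walshCoeffD b f k‖ ^ 2 = ∫ η, ‖f η‖ ^ 2 ∂digitSeqMeasure b :=
  (hasSum_norm_sq_walshCoeffD hb hf).tsum_eq

/-- **Tail form of Parseval**: the `L_2`-error of the `m`-th partial sum is the tail sum of squares,
`∫ |f - S_m(·, f)|² = Σ_{k ≥ m} |f̂(k)|²`. [cite: DickPillichshammer2010, Thm. A.19]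
(with (A.2), p. 549) -/
theorem hasSum_norm_sq_walshCoeffD_add (hb : 1 < b) {f : (ℕ → Fin b) → ℂ}
    (hf : MemLp f 2 (digitSeqMeasure b)) (m : ℕ) :
    HasSum (fun k => ‖walshCoeffD b f (k + m)‖ ^ 2)
      (∫ η, ‖f η - walshSum b (range m) f η‖ ^ 2 ∂digitSeqMeasure b) := by
  have h := (hasSum_nat_add_iff' m).2 (hasSum_norm_sq_walshCoeffD hb hf)
  rwa [integral_norm_sq_eq_add_sum_norm_sq_walshCoeffD hb hf (range m), add_sub_cancel_right] at h

/-- **Theorem A.11, completeness of the Walsh system `𝒲 = {wal_k : k ∈ ℕ₀}` in `L_2`**: an `L_2`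
function all of whose Walsh coefficients vanish is `0` almost everywhere
(`(span 𝒲)^⊥ = {0}`). [cite: DickPillichshammer2010, Thm. A.11] -/
theorem ae_eq_zero_of_forall_walshCoeffD_eq_zero (hb : 1 < b) {f : (ℕ → Fin b) → ℂ}
    (hf : MemLp f 2 (digitSeqMeasure b)) (h : ∀ k, walshCoeffD b f k = 0) :
    f =ᵐ[digitSeqMeasure b] 0 := by
  have hP := hasSum_norm_sq_walshCoeffD hb hf
  simp_rw [h, norm_zero] at hP
  have h0 : ∫ η, ‖f η‖ ^ 2 ∂digitSeqMeasure b = 0 := by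
    have h' : HasSum (fun _ : ℕ => (0 : ℝ)) (∫ η, ‖f η‖ ^ 2 ∂digitSeqMeasure b) := by
      simpa using hP
    exact (h'.unique hasSum_zero)
  have hae := (integral_eq_zero_iff_of_nonneg (fun η => sq_nonneg _) (integrable_norm_sq hf)).1 h0
  filter_upwards [hae] with η hη
  simpa using hη

/-- **Uniqueness of Walsh coefficients**: two `L_2` functions with the same Walsh coefficients
agree almost everywhere. [cite: DickPillichshammer2010, Thm. A.11] -/
theorem ae_eq_of_forall_walshCoeffD_eq (hb : 1 < b) {f g : (ℕ → Fin b) → ℂ}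
    (hf : MemLp f 2 (digitSeqMeasure b)) (hg : MemLp g 2 (digitSeqMeasure b))
    (h : ∀ k, walshCoeffD b f k = walshCoeffD b g k) : f =ᵐ[digitSeqMeasure b] g := by
  have hfg : ∀ k, walshCoeffD b (f - g) k = 0 := by
    intro k
    have hI := integrable_mul_conj_walshD'' (integrable_of_memLp_two hf) k
    have hJ := integrable_mul_conj_walshD'' (integrable_of_memLp_two hg) k
    rw [walshCoeffD]
    simp_rw [Pi.sub_apply, sub_mul]
    rw [integral_sub hI hJ, ← walshCoeffD, ← walshCoeffD, h k, sub_self]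
  have h0 := ae_eq_zero_of_forall_walshCoeffD_eq_zero hb (hf.sub hg) hfg
  filter_upwards [h0] with η hη
  exact sub_eq_zero.1 hη

/-! ### The nested ANOVA variances sum to the variance: eq. (13.6) -/

/-- Block regrouping: `Σ_{ℓ=0}^{L} σ_ℓ² = Σ_{1 ≤ k < b^L} |c_k|²` (`σ_0² = 0`).
[cite: DickPillichshammer2010, §13.2] (p. 402, the display before (13.6):
`Σ_{k=1}^∞ |f̂(k)|² = Σ_{ℓ=1}^∞ σ_ℓ²(f)`, finite form) -/
theorem sum_range_succ_blockVariance (c : ℕ → ℂ) (L : ℕ) :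
    ∑ ℓ ∈ range (L + 1), blockVariance b c ℓ = ∑ k ∈ Ico 1 (b ^ L), ‖c k‖ ^ 2 := by
  have hb0 : 0 < b := Nat.pos_of_ne_zero (NeZero.ne b)
  induction L with
  | zero => simp [blockVariance]
  | succ L ih =>
    rw [sum_range_succ, ih, blockVariance, Nat.add_sub_cancel,
      sum_Ico_consecutive _ (Nat.one_le_pow _ _ hb0) (Nat.pow_le_pow_right hb0 (Nat.le_succ L))]

/-- **Eq. (13.6)**: the nested ANOVA variances of `f ∈ L_2` sum to its variance,
`Σ_{ℓ=1}^∞ σ_ℓ²(f) = Σ_{k=1}^∞ |f̂(k)|² = ∫ |f|² - |∫ f|² = Var[f]` (here with `σ_0² := 0`, and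
`f̂(0) = ∫ f`). [cite: DickPillichshammer2010, eq. (13.6)] (p. 402: "`β_ℓ` is a martingale …
`Σ_{ℓ=1}^∞ σ_ℓ²(f) = σ²(f)`"; by Parseval, [cite: DickPillichshammer2010, Thm. A.19]) -/
theorem hasSum_blockVariance_walshCoeffD (hb : 1 < b) {f : (ℕ → Fin b) → ℂ}
    (hf : MemLp f 2 (digitSeqMeasure b)) :
    HasSum (fun ℓ => blockVariance b (walshCoeffD b f) ℓ)
      (∫ η, ‖f η‖ ^ 2 ∂digitSeqMeasure b - ‖∫ η, f η ∂digitSeqMeasure b‖ ^ 2) := by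
  have hb0 : 0 < b := Nat.pos_of_ne_zero (NeZero.ne b)
  have hnn : ∀ ℓ, 0 ≤ blockVariance b (walshCoeffD b f) ℓ :=
    fun ℓ => sum_nonneg fun k _ => sq_nonneg _
  rw [hasSum_iff_tendsto_nat_of_nonneg hnn, ← tendsto_add_atTop_iff_nat 1]
  simp_rw [sum_range_succ_blockVariance]
  have hIco : ∀ L, ∑ k ∈ Ico 1 (b ^ L), ‖walshCoeffD b f k‖ ^ 2 =
      ∑ k ∈ range (b ^ L), ‖walshCoeffD b f k‖ ^ 2 - ‖∫ η, f η ∂digitSeqMeasure b‖ ^ 2 := by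
    intro L
    rw [sum_Ico_eq_sub _ (Nat.one_le_pow _ _ hb0), sum_range_one, walshCoeffD_zero_eq_integral]
  simp_rw [hIco]
  exact ((hasSum_norm_sq_walshCoeffD hb hf).tendsto_sum_nat.comp
    (tendsto_pow_atTop_atTop_of_one_lt hb)).sub_const _

/-- **Variance identity**: `Var[f] = ∫ |f - ∫ f|² = ∫ |f|² - |∫ f|²` for `f ∈ L_2` of the
(probability) digit space — (A.2) with `S = {0}`, since `S_{{0}} f = f̂(0) wal_0 = ∫ f`.
[cite: DickPillichshammer2010, §13.2] (p. 402: `Var[f] = ∫₀¹ |f(y) - 𝔼(f)|² dy`) -/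
theorem integral_norm_sq_sub_integral (hb : 1 < b) {f : (ℕ → Fin b) → ℂ}
    (hf : MemLp f 2 (digitSeqMeasure b)) :
    ∫ η, ‖f η - ∫ ζ, f ζ ∂digitSeqMeasure b‖ ^ 2 ∂digitSeqMeasure b =
      ∫ η, ‖f η‖ ^ 2 ∂digitSeqMeasure b - ‖∫ ζ, f ζ ∂digitSeqMeasure b‖ ^ 2 := by
  have h := integral_norm_sq_eq_add_sum_norm_sq_walshCoeffD hb hf {0}
  simp only [walshSum, sum_singleton, walshCoeffD_zero_eq_integral, walshD_zero, mul_one] at h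
  linarith

/-- **Eq. (13.6), variance form**: `Σ_ℓ σ_ℓ²(f) = Var[f] = ∫ |f - ∫ f|²` for `f ∈ L_2`.
[cite: DickPillichshammer2010, eq. (13.6)] -/
theorem hasSum_blockVariance_walshCoeffD' (hb : 1 < b) {f : (ℕ → Fin b) → ℂ}
    (hf : MemLp f 2 (digitSeqMeasure b)) :
    HasSum (fun ℓ => blockVariance b (walshCoeffD b f) ℓ)
      (∫ η, ‖f η - ∫ ζ, f ζ ∂digitSeqMeasure b‖ ^ 2 ∂digitSeqMeasure b) := by
  rw [integral_norm_sq_sub_integral hb hf]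
  exact hasSum_blockVariance_walshCoeffD hb hf

/-- **Tail of (13.6)**: the `L_2`-distance of `f ∈ L_2` from its level-`L` mean is the tail of the
nested ANOVA variances, `∫ |f - E_L f|² = Σ_{ℓ > L} σ_ℓ²(f)` (since `E_L f = S_{b^L}(·, f)` and
`∫ |f - S_{b^L} f|² = Σ_{k ≥ b^L} |f̂(k)|²`). [cite: DickPillichshammer2010, eq. (13.6)]
[cite: DickPillichshammer2010, Thm. A.19] -/
theorem hasSum_blockVariance_walshCoeffD_add (hb : 1 < b) {f : (ℕ → Fin b) → ℂ}
    (hf : MemLp f 2 (digitSeqMeasure b)) (L : ℕ) :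
    HasSum (fun j => blockVariance b (walshCoeffD b f) (j + (L + 1)))
      (∫ η, ‖f η - levelMean b L f η‖ ^ 2 ∂digitSeqMeasure b) := by
  have hb0 : 0 < b := Nat.pos_of_ne_zero (NeZero.ne b)
  have hfI : Integrable f (digitSeqMeasure b) := integrable_of_memLp_two hf
  have key : ∫ η, ‖f η‖ ^ 2 ∂digitSeqMeasure b - ‖∫ η, f η ∂digitSeqMeasure b‖ ^ 2 -
      ∑ ℓ ∈ range (L + 1), blockVariance b (walshCoeffD b f) ℓ =
      ∫ η, ‖f η - levelMean b L f η‖ ^ 2 ∂digitSeqMeasure b := by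
    rw [sum_range_succ_blockVariance, sum_Ico_eq_sub _ (Nat.one_le_pow _ _ hb0), sum_range_one,
      walshCoeffD_zero_eq_integral,
      integral_norm_sq_eq_add_sum_norm_sq_walshCoeffD hb hf (range (b ^ L))]
    simp_rw [walshSum_range_pow hb hfI]
    ring
  rw [← key]
  exact (hasSum_nat_add_iff' (L + 1)).2 (hasSum_blockVariance_walshCoeffD hb hf)

end Completeness

end Literature.Analysis.Quadrature
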